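import Literature.Barriers.MatrixMultiplication.QuasirandomBarrierLieTypeCReduction
import Literature.Barriers.MatrixMultiplication.PackingBoundSequences
import Literature.RepresentationTheory.FiniteGroups.SpMinimalCharacterDegree
import HarnessLib

/-!
# BCGPU 2023, Cor. 3.4 for `Sp(2n, q)` / `PSp(2n, q)`: the named fact `BCGPU2023_cor34_typeC`
# reduced to the class-number input ALONE (the minimal-degree input is now proved)

Topic `Literature/Barriers/MatrixMultiplication`; sequel to `QuasirandomBarrierLieTypeC.lean` (the
named fact `BCGPU2023_cor34_typeC`) and `QuasirandomBarrierLieTypeCReduction.lean`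
(`BCGPU2023_cor34_typeC_of_inputs`: the fact from the two printed inputs (LS) `n(Sp(2n,q)) ≥ qⁿ/4`
and (FG) `k(Sp(2n,q)) ≤ q^{5n}`, both hypotheses).

Source: J. Blasiak, H. Cohn, J. A. Grochow, K. Pratt, C. Umans, *Matrix multiplication via matrix
groups*, ITCS 2023 = arXiv:2204.03826 [BlasiakCohnGrochowPrattUmans2023], Cor. 3.4 and its proof
(p. 6: "`n(G) ≥ Ω(q^r)` [Landazuri–Seitz]", "`O(q^r)` conjugacy classes [Fulman–Guralnick]";
footnote 2 p. 3 lists `Sp(2n, q)`; p. 7: "also for simple groups that are quotients of groups of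
Lie type by their centers").

## What is proved here (0 `sorry`, 0 new named facts)

* §1 the Landazuri–Seitz-type input for `Sp(2n, q) = Matrix.symplecticGroup (Fin n) F`, now a
  THEOREM of the tree (`Literature/RepresentationTheory/FiniteGroups/SpMinimalCharacterDegree.lean`:
  `Sp2n.le_charDegree_of_three_le`, `q^{n−1} − 1 ≤ d`; `Sp2n.card_le_two_mul_charDegree_add_one`,
  `q ≤ 2d + 1`), in the barrier's currency: **`secondCharDegree_Sp_ge`** (`n(Sp(2(m+1), q)) ≥ q^m/4`,
  `m ≥ 1`) and **`secondCharDegree_Sp_ge_card`** (`n(Sp(2n, q)) ≥ q/4`, all `n ≥ 1`).  The printed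
  input is `n(Sp(2n,q)) ≥ Ω(qⁿ)`; the tree's bound has exponent `n − 1` (restriction to the Siegel
  Levi factor `SL_n(q)`), which serves equally: the engine `exists_eps_noCertificate_family_gen A D`
  only needs `n(G) ≥ q^r/4`, `k(G) ≤ q^{Ar}`, `|G| ≤ q^{Dr²}` for SOME `r ≥ 1`, and `r = max(n−1, 1)`
  works with `A = 10`, `D = 16`.
* §2 **`BCGPU2023_cor34_typeC_of_classNumber`**: the named fact `BCGPU2023_cor34_typeC` follows
  from the class-number input (FG) `k(Sp(2n, 𝔽_q)) ≤ q^{5n}` ALONE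
  [cite: FulmanGuralnick2012, Thm. 3.12 (1) and Thm. 3.13 (2)] (`k(Sp(2n,q)) ≤ 15.2 qⁿ ≤ q^{5n}`),
  stated inline as a hypothesis (D-0026: no new fact).  The discharge of `BCGPU2023_cor34_typeC` is
  therefore EXACTLY the task of proving (FG) for `Matrix.symplecticGroup (Fin n) F` (Wall's
  generating functions; not in the tree).

* §3 (appended 2026-08-27) **the bounded-rank half of Cor. 3.4 for type `C`, UNCONDITIONALLY**, in the
  printed sequence form of Def. 2.3 / Cor. 3.3 (`PackingBoundSequences.lean`): for `n ≥ 1` fixed and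
  any sequence of finite fields `Fᵢ`, neither `Sp(2n, Fᵢ)` nor `PSp(2n, Fᵢ)` meets the packing bound
  (`not_meetsPackingBound_Sp`, `not_meetsPackingBound_PSp`; p. 6: "groups of Lie type of bounded rank
  … satisfy `n(G) ≥ Ω(|G|^δ)` for some constant `δ > 0` [LS74], and this condition suffices by
  Cor. 3.3") — from `secondCharDegree_Sp_ge_max` (`n(Sp(2n,q)) ≥ q^{max(n−1,1)}/4`) and
  `|Sp(2n,q)| ≤ q^{4n²}`, i.e. `n(G) ≥ ¼|G|^{max(n−1,1)/(4n²)}`.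

* §4 (appended) **Cor. 3.4 for symplectic groups of BOUNDED rank, UNCONDITIONAL and uniform in `q`**:
  `exists_eps_noCertificate_boundedRank D R` (the bounded-rank branch of the engine: one
  `ε = ε(D, R) > 0` for every non-abelian `G` with `n(G) ≥ q^r/4`, `|G| ≤ q^{Dr²}`, `1 ≤ r ≤ R` — no
  class-number hypothesis) and **`BCGPU2023_noCertificate_Sp_rank_le N`**: for every `N` ONE `ε > 0`
  such that every TPP triple in every `Sp(2n, 𝔽_q)` and `PSp(2n, 𝔽_q)` with `1 ≤ n ≤ N` (all `q`)
  satisfies `(|S||T||U|)^{(2+ε)/3} ≤ ∑ᵢ dᵢ^{2+ε}` (p. 6: "groups of Lie type of bounded rank … cannot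
  prove `ω = 2` … `n(G) ≥ Ω(|G|^δ)` … suffices by Cor. 3.3").

* §5 (appended) the EFFECTIVE single-group forms for `Sp(2n, q)`: `secondCharDegree_Sp_ge_rpow`
  (`n(Sp(2(m+1),q)) ≥ ¼|G|^{max(m,1)/(4(m+1)²)}`), **`tpp_card_le_Sp_rpow`** (every TPP triple in
  `G = Sp(2(m+1), q)` has `|S||T||U| ≤ 2|G|^{3/2 − max(m,1)/(8(m+1)²)} + |G|` — Thm. 3.2 in its
  Cor. 3.3 form with an explicit exponent; the packing bound `|G|^{3/2−o(1)}` is missed by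
  `|G|^{Ω(1/n)}` for fixed rank).

WHAT THIS IS NOT: not a discharge of `BCGPU2023_cor34_typeC`; no statement about `ω`; nothing about
the other Lie types; the sharp `n(Sp(2n,q)) = ½(qⁿ − 1)` (`q` odd) is not claimed.
-/

noncomputable section

open scoped BigOperators
open Matrix

namespace Literature.Barriers.MatrixMultiplication

open Literature.RepresentationTheory.FiniteGroups Literature.Combinatorics.Additive

/-! ## §1 `n(Sp(2n, q))` in the barrier's currency -/

section MinimalDegree

variable {F : Type} [Field F] [Fintype F] [DecidableEq F]

/-- `n(G) ∈ cd(G)` and `n(G) > 1` for a finite non-abelian group. [cite: BlasiakCohnGrochowPrattUmans2023, Def. 3.1] -/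
private theorem secondCharDegree_mem_Sp {G : Type} [Group G] [Finite G] (hG : ∃ a b : G, a * b ≠ b * a) :
    secondCharDegree G ∈ charDegrees G ∧ 1 < secondCharDegree G := by
  have hne' : {d : ℕ | d ∈ charDegrees G ∧ 1 < d}.Nonempty := by
    obtain ⟨d, hd, h1⟩ := Serre1977_thm9_holds.exists_one_lt_mem_charDegrees G hG
    exact ⟨d, hd, h1⟩
  exact Nat.sInf_mem hne'

/-- **`n(Sp(2n, q)) ≥ q/4` for every `n ≥ 1`** (`q ≤ 2 n(G) + 1` from the Levi/`SL_2` bounds of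
`SpMinimalCharacterDegree.lean`; print: "`n(G) ≥ Ω(q^r)`" [Landazuri–Seitz]).
[cite: BlasiakCohnGrochowPrattUmans2023, Cor. 3.4 (proof)] -/
theorem secondCharDegree_Sp_ge_card (m : ℕ) :
    (Fintype.card F : ℝ) / 4 ≤ secondCharDegree (Matrix.symplecticGroup (Fin (m + 1)) F) := by
  have hq : 2 ≤ Fintype.card F := Fintype.one_lt_card
  have hq' : (2 : ℝ) ≤ Fintype.card F := by exact_mod_cast hq
  obtain ⟨hmem, h1⟩ := secondCharDegree_mem_Sp (Sp.exists_not_commute (F := F) m)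
  have h := Sp2n.card_le_two_mul_charDegree_add_one (F := F) m hmem h1
  have h' : (Fintype.card F : ℝ) ≤ 2 * secondCharDegree (Matrix.symplecticGroup (Fin (m + 1)) F) + 1 := by
    exact_mod_cast h
  linarith

/-- **`n(Sp(2(m+1), q)) ≥ q^m/4` for `m ≥ 1`** (from `q^m − 1 ≤ d` for `m ≥ 2` and `q ≤ 2d + 1` for
`m = 1`; print: "`n(G) ≥ Ω(q^r)`" [Landazuri–Seitz], here with `r = n − 1`).
[cite: BlasiakCohnGrochowPrattUmans2023, Cor. 3.4 (proof)] -/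
theorem secondCharDegree_Sp_ge {m : ℕ} (hm : 1 ≤ m) :
    (Fintype.card F : ℝ) ^ m / 4 ≤ secondCharDegree (Matrix.symplecticGroup (Fin (m + 1)) F) := by
  have hq : 2 ≤ Fintype.card F := Fintype.one_lt_card
  have hq' : (2 : ℝ) ≤ Fintype.card F := by exact_mod_cast hq
  obtain ⟨hmem, h1⟩ := secondCharDegree_mem_Sp (Sp.exists_not_commute (F := F) m)
  rcases Nat.lt_or_ge m 2 with hlt | hge
  · obtain rfl : m = 1 := by omega
    rw [pow_one]
    exact secondCharDegree_Sp_ge_card 1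
  · have h := Sp2n.le_charDegree_of_three_le (F := F) hge hmem h1
    have hpow : 1 ≤ Fintype.card F ^ m := Nat.one_le_pow _ _ (by omega)
    have h' : (Fintype.card F : ℝ) ^ m - 1 ≤ secondCharDegree (Matrix.symplecticGroup (Fin (m + 1)) F) := by
      have := (Nat.cast_le (α := ℝ)).mpr h
      push_cast [Nat.cast_sub hpow] at this
      exact this
    have h2m : (2 : ℝ) ≤ (Fintype.card F : ℝ) ^ m := by
      calc (2 : ℝ) = 2 ^ 1 := by norm_num
        _ ≤ (Fintype.card F : ℝ) ^ 1 := by rw [pow_one, pow_one]; exact hq'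
        _ ≤ (Fintype.card F : ℝ) ^ m := pow_le_pow_right₀ (by linarith) hm
    linarith

end MinimalDegree

/-! ## §2 `BCGPU2023_cor34_typeC` from the class-number input alone -/

section Assembly

/-- **BCGPU 2023, Cor. 3.4 for `Sp(2n, q)` and `PSp(2n, q)`, reduced to the class-number input**:
the named fact `BCGPU2023_cor34_typeC` follows from (FG) `k(Sp(2n, 𝔽_q)) ≤ q^{5n}` for all `n ≥ 1`
and all finite fields (a consequence of Fulman–Guralnick's `k(Sp(2n,q)) ≤ 15.2 qⁿ`,
[cite: FulmanGuralnick2012, Thm. 3.12 (1) and Thm. 3.13 (2)]) — a HYPOTHESIS here, not vendored —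
the minimal-degree input being the tree's `secondCharDegree_Sp_ge` / `secondCharDegree_Sp_ge_card`
(weak Landazuri–Seitz for type `C`, PROVED).  Engine: `exists_eps_noCertificate_family_gen 10 16`
with `r = max(n − 1, 1)` (`n(G) ≥ q^r/4`, `k ≤ q^{5n} ≤ q^{10r}`, `|Sp(2n,q)| ≤ q^{4n²} ≤ q^{16r²}`);
the `PSp` case by `k(PSp) ≤ k(Sp)`, `n(PSp) ≥ n(Sp)`, `|PSp| ≤ |Sp|`.
[cite: BlasiakCohnGrochowPrattUmans2023, Cor. 3.4] -/
theorem BCGPU2023_cor34_typeC_of_classNumber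
    (hFG : ∀ (F : Type) [Field F] [Fintype F] (n : ℕ), 1 ≤ n →
      Nat.card (ConjClasses (Matrix.symplecticGroup (Fin n) F)) ≤ Fintype.card F ^ (5 * n)) :
    BCGPU2023_cor34_typeC := by
  classical
  obtain ⟨ε, hε, hfam⟩ := exists_eps_noCertificate_family_gen 10 16
  refine ⟨ε, hε, ?_⟩
  intro F _ _ n hn
  obtain ⟨m, rfl⟩ : ∃ m, n = m + 1 := ⟨n - 1, by omega⟩
  letI : Fintype (Matrix.symplecticGroup (Fin (m + 1)) F) := Fintype.ofFinite _
  letI : Fintype (Matrix.symplecticGroup (Fin (m + 1)) F ⧸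
      Subgroup.center (Matrix.symplecticGroup (Fin (m + 1)) F)) := Fintype.ofFinite _
  set q : ℕ := Fintype.card F with hq
  have hq2 : 2 ≤ q := Fintype.one_lt_card
  have hq1 : 1 ≤ q := by omega
  -- the rank parameter `r = max(m, 1)`
  set r : ℕ := max m 1 with hr
  have hr1 : 1 ≤ r := le_max_right _ _
  have hmr : m ≤ r := le_max_left _ _
  have hG := Sp.exists_not_commute (F := F) m
  have hν : (q : ℝ) ^ r / 4 ≤ secondCharDegree (Matrix.symplecticGroup (Fin (m + 1)) F) := by
    rcases Nat.eq_zero_or_pos m with h0 | hm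
    · have hr' : r = 1 := by rw [hr, h0]; rfl
      rw [hr', pow_one]
      exact secondCharDegree_Sp_ge_card m
    · have hr' : r = m := by rw [hr, max_eq_left hm]
      rw [hr']
      exact secondCharDegree_Sp_ge hm
  have hkNat : Nat.card (ConjClasses (Matrix.symplecticGroup (Fin (m + 1)) F)) ≤ q ^ (10 * r) :=
    (hFG F (m + 1) hn).trans (Nat.pow_le_pow_right hq1 (by omega))
  have hk : (Nat.card (ConjClasses (Matrix.symplecticGroup (Fin (m + 1)) F)) : ℝ) ≤
      (q : ℝ) ^ (10 * r) := by exact_mod_cast hkNat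
  have hcardNat : Fintype.card (Matrix.symplecticGroup (Fin (m + 1)) F) ≤ q ^ (16 * r * r) :=
    (Sp.card_le_pow (F := F) (m + 1)).trans (Nat.pow_le_pow_right hq1 (by nlinarith))
  have hcard : (Fintype.card (Matrix.symplecticGroup (Fin (m + 1)) F) : ℝ) ≤
      (q : ℝ) ^ (16 * r * r) := by exact_mod_cast hcardNat
  constructor
  · intro S T U hTPP
    exact hfam q r hq2 hr1 _ hG hν hk hcard S T U hTPP
  · intro S T U hTPP
    have hQ := PSp.exists_not_commute (F := F) m
    have hνQ : (q : ℝ) ^ r / 4 ≤ secondCharDegree (Matrix.symplecticGroup (Fin (m + 1)) F ⧸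
        Subgroup.center (Matrix.symplecticGroup (Fin (m + 1)) F)) :=
      hν.trans (by exact_mod_cast secondCharDegree_le_quotient _ hQ)
    have hkQ : (Nat.card (ConjClasses (Matrix.symplecticGroup (Fin (m + 1)) F ⧸
        Subgroup.center (Matrix.symplecticGroup (Fin (m + 1)) F))) : ℝ) ≤ (q : ℝ) ^ (10 * r) := by
      exact_mod_cast (card_conjClasses_quotient_le _).trans hkNat
    have hcardQ : (Fintype.card (Matrix.symplecticGroup (Fin (m + 1)) F ⧸
        Subgroup.center (Matrix.symplecticGroup (Fin (m + 1)) F)) : ℝ) ≤ (q : ℝ) ^ (16 * r * r) := by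
      exact_mod_cast (Fintype.card_le_of_surjective _ (QuotientGroup.mk_surjective)).trans hcardNat
    exact hfam q r hq2 hr1 _ hQ hνQ hkQ hcardQ S T U hTPP

end Assembly

/-! ## §3 Fixed rank: `Sp(2n, Fᵢ)`, `PSp(2n, Fᵢ)` do not meet the packing bound (unconditional) -/

section FixedRank

/-- `n(Sp(2(m+1), q)) ≥ q^{max(m,1)}/4` — the two bounds of §1 in one formula (the rank parameter
`r = max(n − 1, 1)` of `BCGPU2023_cor34_typeC_of_classNumber`).
[cite: BlasiakCohnGrochowPrattUmans2023, Cor. 3.4 (proof)] -/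
theorem secondCharDegree_Sp_ge_max {F : Type} [Field F] [Fintype F] [DecidableEq F] (m : ℕ) :
    (Fintype.card F : ℝ) ^ max m 1 / 4 ≤ secondCharDegree (Matrix.symplecticGroup (Fin (m + 1)) F) := by
  rcases Nat.eq_zero_or_pos m with h0 | hm
  · have hr' : max m 1 = 1 := by rw [h0]; rfl
    rw [hr', pow_one]
    exact secondCharDegree_Sp_ge_card m
  · rw [max_eq_left hm]
    exact secondCharDegree_Sp_ge hm

variable (F : ℕ → Type) [∀ i, Field (F i)] [∀ i, Fintype (F i)] [∀ i, DecidableEq (F i)]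

/-- **BCGPU 2023, Cor. 3.4 (proof, bounded rank), type `C`, unconditional**: for `n ≥ 1` fixed and
any sequence of finite fields `Fᵢ`, the sequence `Sp(2n, Fᵢ)` (`Matrix.symplecticGroup (Fin n) (Fᵢ)`)
does not meet the packing bound (Def. 2.3, `MeetsPackingBound`): `n(Sp(2n,q)) ≥ q^{max(n−1,1)}/4`
(tree, weak Landazuri–Seitz) and `|Sp(2n,q)| ≤ q^{4n²}` give `n(G) ≥ ¼|G|^δ` with
`δ = max(n−1,1)/(4n²) > 0`, and Cor. 3.3 (`BCGPU2023_cor33_seq`) applies.  The `Fintype` instances on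
the groups are arbitrary (instance arguments).
[cite: BlasiakCohnGrochowPrattUmans2023, Cor. 3.4 (proof, first paragraph) and Cor. 3.3] -/
theorem not_meetsPackingBound_Sp {n : ℕ} (hn : 1 ≤ n)
    [∀ i, Fintype (Matrix.symplecticGroup (Fin n) (F i))] :
    ¬ MeetsPackingBound (fun i => Matrix.symplecticGroup (Fin n) (F i)) := by
  obtain ⟨m, rfl⟩ : ∃ m, n = m + 1 := ⟨n - 1, by omega⟩
  refine BCGPU2023_cor33_seq _ (c := 1 / 4) (δ := (max m 1 : ℕ) / ((4 * (m + 1) * (m + 1) : ℕ) : ℝ))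
    (by norm_num) (by positivity) (Filter.Eventually.of_forall fun i => ?_)
  have h := secondCharDegree_ge_rpow_of_card_le (G := Matrix.symplecticGroup (Fin (m + 1)) (F i))
    (q := Fintype.card (F i)) (m := max m 1) (d := 4 * (m + 1) * (m + 1)) (by positivity)
    (secondCharDegree_Sp_ge_max m) (by convert Sp.card_le_pow (F := F i) (m + 1) using 2)
  exact h

/-- The same for the central quotients `PSp(2n, Fᵢ) = Sp(2n, Fᵢ)/Z` ("also for simple groups that
are quotients of groups of Lie type by their centers", p. 7): `n(PSp) ≥ n(Sp)` (inflation,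
`secondCharDegree_le_quotient`) and `|PSp| ≤ |Sp|`.
[cite: BlasiakCohnGrochowPrattUmans2023, Cor. 3.4 (proof, first paragraph, and the remark following the proof)] -/
theorem not_meetsPackingBound_PSp {n : ℕ} (hn : 1 ≤ n)
    [∀ i, Fintype (Matrix.symplecticGroup (Fin n) (F i))]
    [∀ i, Fintype (Matrix.symplecticGroup (Fin n) (F i) ⧸
      Subgroup.center (Matrix.symplecticGroup (Fin n) (F i)))] :
    ¬ MeetsPackingBound (fun i => Matrix.symplecticGroup (Fin n) (F i) ⧸
      Subgroup.center (Matrix.symplecticGroup (Fin n) (F i))) := by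
  obtain ⟨m, rfl⟩ : ∃ m, n = m + 1 := ⟨n - 1, by omega⟩
  refine BCGPU2023_cor33_seq _ (c := 1 / 4) (δ := (max m 1 : ℕ) / ((4 * (m + 1) * (m + 1) : ℕ) : ℝ))
    (by norm_num) (by positivity) (Filter.Eventually.of_forall fun i => ?_)
  have hQ := PSp.exists_not_commute (F := F i) m
  have hνQ : (Fintype.card (F i) : ℝ) ^ max m 1 / 4 ≤
      secondCharDegree (Matrix.symplecticGroup (Fin (m + 1)) (F i) ⧸
        Subgroup.center (Matrix.symplecticGroup (Fin (m + 1)) (F i))) :=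
    (secondCharDegree_Sp_ge_max m).trans (by exact_mod_cast secondCharDegree_le_quotient _ hQ)
  have hcardQ : Fintype.card (Matrix.symplecticGroup (Fin (m + 1)) (F i) ⧸
      Subgroup.center (Matrix.symplecticGroup (Fin (m + 1)) (F i))) ≤
      Fintype.card (F i) ^ (4 * (m + 1) * (m + 1)) := by
    refine (Fintype.card_le_of_surjective _ (QuotientGroup.mk_surjective)).trans ?_
    convert Sp.card_le_pow (F := F i) (m + 1) using 2
  exact secondCharDegree_ge_rpow_of_card_le (m := max m 1) (by positivity) hνQ hcardQ

end FixedRank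

/-! ## §4 Bounded rank: one `ε` for all `Sp(2n, q)`, `PSp(2n, q)` with `n ≤ N` (unconditional) -/

section BoundedRank

/-- **The bounded-rank branch of the engine** (Cor. 3.4, proof, first paragraph: bounded rank needs
only `n(G) ≥ Ω(|G|^δ)` and Cor. 3.3 — NO class-number input): for all `D, R` there is `ε > 0` such
that every finite non-abelian `G` with parameters `q ≥ 2`, `1 ≤ r ≤ R`, `n(G) ≥ q^r/4` and
`|G| ≤ q^{Dr²}` satisfies Thm. 2.2's inequality at `w = 2 + ε` for all TPP triples
(`n(G) ≥ ¼|G|^{1/((R+1)(D+1))}` for `|G| ≥ N₀` by Cor. 3.3; Cor. 3.5 for `12 ≤ |G| < N₀`; the finite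
check for `|G| ≤ 11`). [cite: BlasiakCohnGrochowPrattUmans2023, Cor. 3.4 (proof, first paragraph) and Cor. 3.3] -/
theorem exists_eps_noCertificate_boundedRank (D R : ℕ) :
    ∃ ε : ℝ, 0 < ε ∧ ∀ (q r : ℕ), 2 ≤ q → 1 ≤ r → r ≤ R →
      ∀ (G : Type) [Group G] [Fintype G], (∃ a b : G, a * b ≠ b * a) →
        (q : ℝ) ^ r / 4 ≤ secondCharDegree G →
        (Fintype.card G : ℝ) ≤ (q : ℝ) ^ (D * r * r) →
        ∀ (S T U : Finset G), TripleProductProperty S T U →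
          ((S.card * T.card * U.card : ℕ) : ℝ) ^ ((2 + ε) / 3) ≤ charDegreePowSum G (2 + ε) := by
  classical
  obtain ⟨ε₂, hε₂, N₀, hN₀⟩ :=
    exists_eps_noCertificate_of_secondCharDegree_ge (c := 1 / 4)
      (δ := 1 / (((R : ℝ) + 1) * ((D : ℝ) + 1))) (by norm_num) (by positivity)
  obtain ⟨ε₃, hε₃, hsmall⟩ := exists_eps_noCertificate_of_card_le N₀
  set ε : ℝ := min (1 / 200) (min ε₂ ε₃) with hεdef
  have hε0 : 0 < ε := lt_min (by norm_num) (lt_min hε₂ hε₃)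
  have hε200 : ε ≤ 1 / 200 := min_le_left _ _
  have hεε₂ : ε ≤ ε₂ := (min_le_right _ _).trans (min_le_left _ _)
  have hεε₃ : ε ≤ ε₃ := (min_le_right _ _).trans (min_le_right _ _)
  refine ⟨ε, hε0, ?_⟩
  intro q r hq hr hrR G _ _ hG hν hcard S T U hTPP
  have hq1 : (1 : ℝ) ≤ q := by exact_mod_cast (by omega : 1 ≤ q)
  have hq0 : (0 : ℝ) < q := by linarith
  have hw2 : (2 : ℝ) ≤ 2 + ε := by linarith
  by_cases hbig : N₀ ≤ Fintype.card G
  · -- Cor. 3.3 with `c = 1/4`, `δ = 1/((R+1)(D+1))`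
    have hmν : (1 / 4 : ℝ) * (Fintype.card G : ℝ) ^ (1 / (((R : ℝ) + 1) * ((D : ℝ) + 1))) ≤
        secondCharDegree G := by
      have hG0 : (0 : ℝ) ≤ Fintype.card G := Nat.cast_nonneg _
      have hexp : D * r * r ≤ (R + 1) * (D + 1) * r := by
        calc D * r * r ≤ D * R * r := by gcongr
          _ ≤ (R + 1) * (D + 1) * r := by nlinarith
      have hcard' : (Fintype.card G : ℝ) ≤ (q : ℝ) ^ ((R + 1) * (D + 1) * r) :=
        hcard.trans (pow_le_pow_right₀ hq1 hexp)
      have h1 : (Fintype.card G : ℝ) ^ (1 / (((R : ℝ) + 1) * ((D : ℝ) + 1))) ≤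
          ((q : ℝ) ^ ((R + 1) * (D + 1) * r)) ^ (1 / (((R : ℝ) + 1) * ((D : ℝ) + 1))) :=
        Real.rpow_le_rpow hG0 hcard' (by positivity)
      have h2 : ((q : ℝ) ^ ((R + 1) * (D + 1) * r)) ^ (1 / (((R : ℝ) + 1) * ((D : ℝ) + 1))) =
          (q : ℝ) ^ r := by
        rw [← Real.rpow_natCast _ ((R + 1) * (D + 1) * r), ← Real.rpow_mul hq0.le,
          ← Real.rpow_natCast _ r]
        congr 1
        push_cast
        field_simp
      rw [h2] at h1
      linarith [hν]
    exact hN₀ G hG hbig hmν S T U hTPP (2 + ε) hw2 (by linarith)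
  · push Not at hbig
    by_cases h12 : 12 ≤ Fintype.card G
    · exact hsmall G h12 hbig.le S T U hTPP (2 + ε) hw2 (by linarith)
    · push Not at h12
      exact noCertificate_of_card_le_eleven G (by omega) S T U hTPP hw2 (by linarith)

/-- **BCGPU 2023, Cor. 3.4 for `Sp(2n, q)`, `PSp(2n, q)` of bounded rank — PROVED**: for every `N`
there is ONE `ε > 0` such that for every finite field `F` and every `1 ≤ n ≤ N`, every TPP triple in
`Sp(2n, F) = Matrix.symplecticGroup (Fin n) F` and in its central quotient `PSp(2n, F)` satisfies
the inequality of Thm. 2.2 AT `w = 2 + ε`, i.e. Thm. 2.2 cannot certify `ω < 2 + ε` from any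
symplectic group of rank `≤ N` (p. 6: "groups of Lie type of bounded rank … cannot prove `ω = 2`
… `n(G) ≥ Ω(|G|^δ)` [Landazuri–Seitz] … suffices by Cor. 3.3").  Inputs: the tree's weak
Landazuri–Seitz bound `secondCharDegree_Sp_ge_max` (`n(Sp(2n,q)) ≥ q^{max(n−1,1)}/4`),
`|Sp(2n,q)| ≤ q^{4n²} ≤ q^{16 r²}`, and `exists_eps_noCertificate_boundedRank 16 N`.  Unbounded rank
is `BCGPU2023_cor34_typeC_of_classNumber` (conditional on the class-number input).
[cite: BlasiakCohnGrochowPrattUmans2023, Cor. 3.4] -/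
theorem BCGPU2023_noCertificate_Sp_rank_le (N : ℕ) :
    ∃ ε : ℝ, 0 < ε ∧ ∀ (F : Type) [Field F] [Fintype F] (n : ℕ), 1 ≤ n → n ≤ N →
      (∀ (S T U : Finset (Matrix.symplecticGroup (Fin n) F)), TripleProductProperty S T U →
        ((S.card * T.card * U.card : ℕ) : ℝ) ^ ((2 + ε) / 3) ≤
          charDegreePowSum (Matrix.symplecticGroup (Fin n) F) (2 + ε)) ∧
      (∀ (S T U : Finset (Matrix.symplecticGroup (Fin n) F ⧸
          Subgroup.center (Matrix.symplecticGroup (Fin n) F))), TripleProductProperty S T U →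
        ((S.card * T.card * U.card : ℕ) : ℝ) ^ ((2 + ε) / 3) ≤
          charDegreePowSum (Matrix.symplecticGroup (Fin n) F ⧸
            Subgroup.center (Matrix.symplecticGroup (Fin n) F)) (2 + ε)) := by
  classical
  obtain ⟨ε, hε, hfam⟩ := exists_eps_noCertificate_boundedRank 16 N
  refine ⟨ε, hε, ?_⟩
  intro F _ _ n hn hnN
  obtain ⟨m, rfl⟩ : ∃ m, n = m + 1 := ⟨n - 1, by omega⟩
  letI : Fintype (Matrix.symplecticGroup (Fin (m + 1)) F) := Fintype.ofFinite _
  letI : Fintype (Matrix.symplecticGroup (Fin (m + 1)) F ⧸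
      Subgroup.center (Matrix.symplecticGroup (Fin (m + 1)) F)) := Fintype.ofFinite _
  set q : ℕ := Fintype.card F with hq
  have hq2 : 2 ≤ q := Fintype.one_lt_card
  have hq1 : 1 ≤ q := by omega
  set r : ℕ := max m 1 with hr
  have hr1 : 1 ≤ r := le_max_right _ _
  have hmr : m ≤ r := le_max_left _ _
  have hrN : r ≤ N := max_le (by omega) (by omega)
  have hG := Sp.exists_not_commute (F := F) m
  have hν : (q : ℝ) ^ r / 4 ≤ secondCharDegree (Matrix.symplecticGroup (Fin (m + 1)) F) :=
    secondCharDegree_Sp_ge_max m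
  have hcardNat : Fintype.card (Matrix.symplecticGroup (Fin (m + 1)) F) ≤ q ^ (16 * r * r) :=
    (Sp.card_le_pow (F := F) (m + 1)).trans (Nat.pow_le_pow_right hq1 (by nlinarith))
  have hcard : (Fintype.card (Matrix.symplecticGroup (Fin (m + 1)) F) : ℝ) ≤
      (q : ℝ) ^ (16 * r * r) := by exact_mod_cast hcardNat
  constructor
  · intro S T U hTPP
    exact hfam q r hq2 hr1 hrN _ hG hν hcard S T U hTPP
  · intro S T U hTPP
    have hQ := PSp.exists_not_commute (F := F) m
    have hνQ : (q : ℝ) ^ r / 4 ≤ secondCharDegree (Matrix.symplecticGroup (Fin (m + 1)) F ⧸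
        Subgroup.center (Matrix.symplecticGroup (Fin (m + 1)) F)) :=
      hν.trans (by exact_mod_cast secondCharDegree_le_quotient _ hQ)
    have hcardQ : (Fintype.card (Matrix.symplecticGroup (Fin (m + 1)) F ⧸
        Subgroup.center (Matrix.symplecticGroup (Fin (m + 1)) F)) : ℝ) ≤ (q : ℝ) ^ (16 * r * r) := by
      exact_mod_cast (Fintype.card_le_of_surjective _ (QuotientGroup.mk_surjective)).trans hcardNat
    exact hfam q r hq2 hr1 hrN _ hQ hνQ hcardQ S T U hTPP

end BoundedRank

/-! ## §5 Effective single-group forms for `Sp(2n, q)` -/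

section Effective

variable {F : Type} [Field F] [Fintype F] [DecidableEq F]

/-- `n(Sp(2(m+1), q)) ≥ ¼ |Sp(2(m+1), q)|^{max(m,1)/(4(m+1)²)}` — the hypothesis "`n(G) ≥ c|G|^δ`" of
Cor. 3.3 with `c = 1/4`, `δ = max(m,1)/(4(m+1)²)` (from `q^{max(m,1)}/4 ≤ n(G)` and
`|G| ≤ q^{4(m+1)²}`).  The `Fintype` instance is arbitrary.
[cite: BlasiakCohnGrochowPrattUmans2023, Cor. 3.3 and Cor. 3.4 (proof, bounded rank)] -/
theorem secondCharDegree_Sp_ge_rpow (m : ℕ) [Fintype (Matrix.symplecticGroup (Fin (m + 1)) F)] :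
    (1 / 4 : ℝ) * (Fintype.card (Matrix.symplecticGroup (Fin (m + 1)) F) : ℝ) ^
        (((max m 1 : ℕ) : ℝ) / ((4 * (m + 1) * (m + 1) : ℕ) : ℝ)) ≤
      secondCharDegree (Matrix.symplecticGroup (Fin (m + 1)) F) :=
  secondCharDegree_ge_rpow_of_card_le (m := max m 1) (by positivity) (secondCharDegree_Sp_ge_max m)
    (by convert Sp.card_le_pow (F := F) (m + 1) using 2)

/-- **BCGPU 2023, Thm. 3.2 / Cor. 3.3 for `Sp(2n, q)`, effective**: every TPP triple `S, T, U` in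
`G = Sp(2(m+1), 𝔽_q)` has `|S||T||U| ≤ 2|G|^{3/2 − max(m,1)/(8(m+1)²)} + |G|` (the tree's
`BCGPU2023_thm32_holds.cor33` with `c = 1/4`, `δ = max(m,1)/(4(m+1)²)`) — bounded away from the
packing bound `|G|^{3/2−o(1)}` for fixed rank.  The `Fintype` instance is arbitrary.
[cite: BlasiakCohnGrochowPrattUmans2023, Thm. 3.2, Cor. 3.3 and Cor. 3.4 (proof, bounded rank)] -/
theorem tpp_card_le_Sp_rpow (m : ℕ) [Fintype (Matrix.symplecticGroup (Fin (m + 1)) F)]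
    (S T U : Finset (Matrix.symplecticGroup (Fin (m + 1)) F)) (hTPP : TripleProductProperty S T U) :
    ((S.card * T.card * U.card : ℕ) : ℝ) ≤
      2 * (Fintype.card (Matrix.symplecticGroup (Fin (m + 1)) F) : ℝ) ^
          (3 / 2 - (((max m 1 : ℕ) : ℝ) / ((4 * (m + 1) * (m + 1) : ℕ) : ℝ)) / 2 : ℝ) +
        Fintype.card (Matrix.symplecticGroup (Fin (m + 1)) F) := by
  have h := BCGPU2023_thm32_holds.cor33 (Matrix.symplecticGroup (Fin (m + 1)) F)
    (Sp.exists_not_commute (F := F) m) (c := 1 / 4)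
    (δ := ((max m 1 : ℕ) : ℝ) / ((4 * (m + 1) * (m + 1) : ℕ) : ℝ)) (by norm_num)
    (secondCharDegree_Sp_ge_rpow m) S T U hTPP
  have hs : Real.sqrt (1 / 4 : ℝ) = 1 / 2 := by
    rw [show (1 / 4 : ℝ) = (1 / 2) ^ 2 by norm_num, Real.sqrt_sq (by norm_num)]
  rw [hs] at h
  have e : (Fintype.card (Matrix.symplecticGroup (Fin (m + 1)) F) : ℝ) ^
        (3 / 2 - (((max m 1 : ℕ) : ℝ) / ((4 * (m + 1) * (m + 1) : ℕ) : ℝ)) / 2 : ℝ) / (1 / 2) =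
      2 * (Fintype.card (Matrix.symplecticGroup (Fin (m + 1)) F) : ℝ) ^
        (3 / 2 - (((max m 1 : ℕ) : ℝ) / ((4 * (m + 1) * (m + 1) : ℕ) : ℝ)) / 2 : ℝ) := by
    ring
  linarith [h, e]

end Effective

end Literature.Barriers.MatrixMultiplication

end
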